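import Summits.BirchSwinnertonDyer.BirchSwinnertonDyer.Theses.ByReductionTypeAtTwo
import Summits.BirchSwinnertonDyer.BirchSwinnertonDyer.Theorems.ByReductionTypeAtTwoRankOneAtTwoFklDefs
import Summits.BirchSwinnertonDyer.BirchSwinnertonDyer.Theorems.ByReductionTypeAtTwoRankOneAtTwoBigImageOddLocalFklResidues
import Summits.BirchSwinnertonDyer.BirchSwinnertonDyer.Theorems.ByReductionTypeAtTwoRankOneAtTwoBigImageOddLocalStubShaAnRationalOnSlice
import Literature.Barriers.BirchSwinnertonDyer.PAdicFunctionalEquationParityProofs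
import Literature.NumberTheory.EllipticCurves.NonEisensteinPrimeOfSurjective
import HarnessLib

/-!
# Line `fkl` of crux `RankOneAtTwoBigImageOddLocal` (stmt-BirchSwinnertonDyer-23715, route ByReductionTypeAtTwo):
# ASSEMBLY — the crux BY NAME from five printed named facts and the six named open residues; and the two HALF-SLICES

Lead prover seat `bsd-line-fkl-p1` (g5), helper `--supports stmt-BirchSwinnertonDyer-23715`.  This is the registered skeleton
`Cruxes/RankOneAtTwoBigImageOddLocal/Lines/fkl.lean` (v7/v8) with its seven `sorry`d stubs turned into HYPOTHESES that are now
NAMED tree `Prop`s (`…Theorems.RankOneAtTwoFklDefs`, this gen): a sorry-free, kernel-checked CONDITIONAL proof of the route decl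

  `rankOneAtTwoBigImageOddLocal_of_residues :
     GZK → modularity → Abbes–Ullmo → Česnavičius → GZ86 I.(7.3) →                         -- five PRINTED named facts (tree)
     FirstLayerHigherCongruenceAtTwo → FirstLayerNonVanishingAtTwo →                       -- (2a) HC, (2b) NV
     AnalyticFirstLayerHigherCongruenceAtTwo → AnalyticFirstLayerNonVanishingAtTwo →       -- (3a) HC_an, (3b) NV_an
     ManinOddAdditiveAtTwo → ShaAnTwoIntegralOnBigImageSlice →                             -- (4), (5)
     Theses.ByReductionTypeAtTwo.RankOneAtTwoBigImageOddLocal`.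

So the crux item can be re-typed by the planner (D-0014 plan note of g0/g2, the route's own 19096 ↦ `MultPublishedInputsAtTwo`
pattern) as «published inputs → six named residues → crux», each residue an item of its own — the promote-stub recommendation
made concrete.  The gate records this theorem as a conditional result; it closes nothing by itself.

THE TWO HALF-SLICES (new, per curve, fact-free): the four first-layer residues are used CROSSWISE (`…FklResidues`), so on each
half of the slice only TWO of them are load-bearing —
* `bsdp_two_of_sha_two_trivial_of_nonVanishing_of_analyticHigherCongruence`: a slice curve with `#Ш[2^∞] = 1` (⟺ `Ш(E)[2] = 0`)
  satisfies `BSDp W 2` as soon as (NV at `W`: one first-layer row of level `≥ 2` with `δ' ∉ 4ℤ_{(2)}`) and (HC_an at `W`) hold,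
  given the period transfer, rank `1`, and `0 ≤ ord₂ Ш_an` — the algebraic higher congruence (HC) and the analytic non-vanishing
  (NV_an) are idle there.  This is exactly the COMPLEMENT of the residual stub `stub_shaTwoOnSlice` («`Ш(E)[2] ≠ 0`») of the
  cell's other line `Lines/egg_kolyvagin_two.lean` v6: on `{Ш[2] = 0}` the two lines now offer independent reductions.
* `bsdp_two_of_shaAn_two_unit_of_higherCongruence_of_analyticNonVanishing`: a slice curve whose `Ш_an` is a `2`-adic UNIT
  satisfies `BSDp W 2` as soon as (HC at `W`) and (NV_an at `W`: one row of level `≥ 2` with `δ' ∉ 4ℤ_{(2)}`) hold — (NV), (HC_an)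
  and the integrality stub are idle there.
Global forms by name: `bsdp_two_on_shaTwoTrivial_of_residues`, `bsdp_two_on_shaAnUnit_of_residues`.
Theorems only; no `def`, no `sorry`; named-fact / conjecture hypotheses are displayed, never discharged.  BSD is not proved by
any of this.
-/

set_option autoImplicit false

noncomputable section

open scoped Classical MatrixGroups ModularForm

set_option linter.dupNamespace false

namespace Summit.BirchSwinnertonDyer.BirchSwinnertonDyer.Theorems.RankOneAtTwoFkl

open CongruenceSubgroup WeierstrassCurve Literature.NumberTheory.EllipticCurves
  Literature.NumberTheory.EllipticCurves.ModularForms Summit.BirchSwinnertonDyer.Rank1Residual.F1Sign2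
  Summit.BirchSwinnertonDyer.BirchSwinnertonDyer.Theses.ByReductionTypeAtTwo

/-! ## Slice bookkeeping -/

/-- `ρ_{W,2}` onto ⇒ `E[2]` irreducible (the `n = 1` instance of the slice binder, via the tree's
`hasIrreducibleModPGaloisRep_of_hasSurjectiveModNGaloisRep`). [folklore] -/
theorem hasIrreducibleModPGaloisRep_two_of_bigImage (W : WeierstrassCurve ℚ) [W.IsElliptic]
    (hsurj : ∀ n : ℕ, W.HasSurjectiveModNGaloisRep ((2 ^ n : ℕ) : ℤ)) : W.HasIrreducibleModPGaloisRep 2 :=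
  hasIrreducibleModPGaloisRep_of_hasSurjectiveModNGaloisRep W 2 (by simpa using hsurj 1)

/-- Analytic rank `1` forces the root number `−1` (parity of the order of vanishing = sign of the functional equation, the
tree's `even_analyticRank_iff_of_isNewformOf_conductorLevel`). [folklore] -/
theorem rootNumber_eq_neg_one_of_analyticRank_eq_one (W : WeierstrassCurve ℚ) [W.IsElliptic] [W.IsGloballyMinimal]
    [NeZero (W.conductorNorm ℤ)] (f : CuspForm (Gamma0 (W.conductorNorm ℤ)) 2) (hf : IsNewformOf W f)
    (han : W.analyticRank = 1) : W.rootNumber = -1 := by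
  rcases W.rootNumber_eq_one_or with h | h
  · exfalso
    have hev : Even W.analyticRank :=
      (Literature.Barriers.BirchSwinnertonDyer.even_analyticRank_iff_of_isNewformOf_conductorLevel hf).mpr h
    rw [han] at hev
    exact Nat.not_even_one hev
  · exact h

/-- **The period transfer at `2` on the whole big-image slice from the three Manin statements** (Abbes–Ullmo for `2 ∤ N`,
Česnavičius for `2 ∥ N`, the named open residue `ManinOddAdditiveAtTwo` for `4 ∣ N`) and the tree's PROVED
`SkinnerUrban2014.exists_unit_mul_plusPeriod_of_irreducible_anyPrime` (`E[2]` irreducible because `ρ_{W,2}` is onto).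
[conjecture] inputs displayed as hypotheses; kernel glue. -/
theorem periodTransferAtTwo_of_maninFacts
    (hAU : abbesUllmo_not_dvd_maninConstant_of_not_dvd_level) (hC : cesnavicius_not_two_dvd_maninConstant_of_two_dvd_level)
    (h4 : ManinOddAdditiveAtTwo)
    (W : WeierstrassCurve ℚ) [W.IsElliptic] [W.IsGloballyMinimal] {N : ℕ} [NeZero N]
    (f : CuspForm (Gamma0 N) 2) (hf : IsNewformOf W f)
    (hsurj : ∀ n : ℕ, W.HasSurjectiveModNGaloisRep ((2 ^ n : ℕ) : ℤ)) : PeriodTransferAtTwo W f := by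
  refine SkinnerUrban2014.exists_unit_mul_plusPeriod_of_irreducible_anyPrime W 2
    (hasIrreducibleModPGaloisRep_two_of_bigImage W hsurj) f hf fun W₀ _ _ D₀ _ hopt => ?_
  by_cases h2 : 2 ∣ N
  · by_cases h4N : 2 ^ 2 ∣ N
    · exact h4 W₀ D₀ hopt h4N
    · exact hC W₀ D₀ hopt h2 h4N
  · exact_mod_cast hAU W₀ D₀ hopt 2 Nat.prime_two h2

/-! ## The crux by name from the named inputs -/

/-- **ASSEMBLY: the crux `RankOneAtTwoBigImageOddLocal` BY NAME from five printed named facts of the tree and the six named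
open residues of line fkl.**  Composition = the registered skeleton's: `w = −1` from `r_an = 1`; the period transfer from the
Manin statements; `Ш_an = q ∈ ℚ^×` from Gross–Zagier I.(7.3) ∧ GZK (`…StubShaAnRationalOnSlice`); K2-F / K2-F_an re-assembled
from their residues (`…FklResidues`); then the tree glue `F1Sign2.bsdp_two_of_firstLayerLaws` (p561832).  Every hypothesis is a
named `Prop` of the tree (five `Literature` facts, six `@[conjecture]`s); nothing is discharged here.
[conjecture] inputs displayed; kernel glue. -/
theorem rankOneAtTwoBigImageOddLocal_of_residues
    (hGZK : rank_eq_analyticRank_of_analyticRank_le_one) (hmod : exists_isNewformOf)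
    (hAU : abbesUllmo_not_dvd_maninConstant_of_not_dvd_level) (hC : cesnavicius_not_two_dvd_maninConstant_of_two_dvd_level)
    (hGZ : GrossZagier1986_thm_I_7_3)
    (hHC : FirstLayerHigherCongruenceAtTwo) (hNV : FirstLayerNonVanishingAtTwo)
    (hHCan : AnalyticFirstLayerHigherCongruenceAtTwo) (hNVan : AnalyticFirstLayerNonVanishingAtTwo)
    (hManin : ManinOddAdditiveAtTwo) (hInt : ShaAnTwoIntegralOnBigImageSlice) :
    Summit.BirchSwinnertonDyer.BirchSwinnertonDyer.Theses.ByReductionTypeAtTwo.RankOneAtTwoBigImageOddLocal := by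
  intro W _ _ hcm hsurj hT hc han
  haveI : NeZero (W.conductorNorm ℤ) := ⟨(W.conductorNorm_pos_holds).ne'⟩
  obtain ⟨f, hf⟩ := hmod W
  have hw : W.rootNumber = -1 := rootNumber_eq_neg_one_of_analyticRank_eq_one W f hf han
  have hper : PeriodTransferAtTwo W f := periodTransferAtTwo_of_maninFacts hAU hC hManin W f hf hsurj
  obtain ⟨q, hq, hq0⟩ := exists_rat_shaAn_eq_and_ne_zero_of_analyticRank_eq_one hGZ hGZK W han
  have hint : 0 ≤ padicValRat 2 q := hInt W hcm hsurj hT hc han q hq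
  exact bsdp_two_of_firstLayerLaws hGZK (firstLayerLawAtTwo_of_residues hHC hNV)
    (analyticFirstLayerLawAtTwo_of_residues hHCan hNVan) W f hf hper hsurj hT hc hw han q hq hq0 hint

/-! ## The two half-slices, per curve (fact-free) -/

/-- **Half-slice `{Ш(E)[2] = 0}`, per curve.**  A curve in the K2-F setting (newform with period transfer, big `2`-adic image,
odd torsion, odd Tamagawa product, `w = −1`, Mordell–Weil rank `1` = analytic rank) whose `Ш[2^∞]` is TRIVIAL satisfies
`BSDp W 2` as soon as: `Ш_an = q ∈ ℚ^×` with `0 ≤ ord₂ q`; (NV at `W`, `s = 0`): some first-layer row of level `k ≥ 2` has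
`δ'_k(ℓ;ψ) ∉ 4ℤ_{(2)}`; (HC_an at `W`): if `s_an ≥ 1` every row of level `k ≥ 2` has `δ' ∈ 2^{min(k, s_an+1)}ℤ_{(2)}`.  Proof: the
rows with `min = 1` of the analytic clause (a) are the theorem `analyticFirstLayerLawAtTwo_clauseA_mod_two`; crosswise
(`shaAn_two_val_le_of_analyticClauseA_of_clauseB`) `s_an ≤ s = 0`, so `ord₂ q = 0 = ord₂ #Ш[2^∞]`.  The algebraic higher
congruence (HC) and the analytic non-vanishing (NV_an) are NOT used on this half. [folklore] kernel glue. -/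
theorem bsdp_two_of_sha_two_trivial_of_nonVanishing_of_analyticHigherCongruence
    (W : WeierstrassCurve ℚ) [W.IsElliptic] [W.IsGloballyMinimal] {M : ℕ} [NeZero M]
    (f : CuspForm (Gamma0 M) 2) (hf : IsNewformOf W f) (hper : PeriodTransferAtTwo W f)
    (hsurj : ∀ n : ℕ, W.HasSurjectiveModNGaloisRep ((2 ^ n : ℕ) : ℤ)) (hT : Odd W.torsionOrder)
    (hc : Odd W.tamagawaProduct) (hw : W.rootNumber = -1) (hr : W.mordellWeilRank = 1) (han : W.analyticRank = 1)
    (hfin : Finite (AddCommGroup.primaryComponent W.sha 2))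
    (hcard : Nat.card (AddCommGroup.primaryComponent W.sha 2) = 1)
    (q : ℚ) (hq : shaAn W = (q : ℂ)) (hq0 : q ≠ 0) (hint : 0 ≤ padicValRat 2 q)
    (hNV : ∃ (ℓ k : ℕ) (_ : Fact ℓ.Prime) (ψ : (ZMod ℓ)ˣ →* Multiplicative (ZMod (2 ^ k))),
      IsLevelAtTwo W ℓ ∧ 2 ≤ k ∧ (2 ^ k : ℤ) ∣ (ℓ : ℤ) - 1 ∧ (2 ^ k : ℤ) ∣ W.frobeniusTrace ℓ - 2 ∧
      Function.Surjective ψ ∧ ¬ InTwoPowZLoc 2 (levelSumTwo f ℓ k ψ))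
    (hHCan : 1 ≤ (padicValRat 2 q).toNat → ∀ (ℓ k : ℕ) [Fact ℓ.Prime], IsLevelAtTwo W ℓ → 2 ≤ k →
      (2 ^ k : ℤ) ∣ (ℓ : ℤ) - 1 → (2 ^ k : ℤ) ∣ W.frobeniusTrace ℓ - 2 →
      ∀ ψ : (ZMod ℓ)ˣ →* Multiplicative (ZMod (2 ^ k)), Function.Surjective ψ →
        InTwoPowZLoc (min k ((padicValRat 2 q).toNat + 1)) (levelSumTwo f ℓ k ψ)) :
    BSDp W 2 := by
  have hs0 : padicValNat 2 (Nat.card (AddCommGroup.primaryComponent W.sha 2)) = 0 := by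
    rw [hcard, padicValNat_one_right]
  -- full analytic clause (a) at `W`
  have ha : ∀ (ℓ k : ℕ) [Fact ℓ.Prime], IsLevelAtTwo W ℓ → 1 ≤ k → (2 ^ k : ℤ) ∣ (ℓ : ℤ) - 1 →
      (2 ^ k : ℤ) ∣ W.frobeniusTrace ℓ - 2 →
      ∀ ψ : (ZMod ℓ)ˣ →* Multiplicative (ZMod (2 ^ k)), Function.Surjective ψ →
        InTwoPowZLoc (min k ((padicValRat 2 q).toNat + 1)) (levelSumTwo f ℓ k ψ) := by
    intro ℓ k _ hlev hk hℓk ha ψ hψ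
    have h1 : InTwoPowZLoc 1 (levelSumTwo f ℓ k ψ) :=
      analyticFirstLayerLawAtTwo_clauseA_mod_two W f hf hper hsurj hT hc hw han q hq hq0 ℓ k hlev hk hℓk ha ψ hψ
    by_cases hs : 1 ≤ (padicValRat 2 q).toNat
    · by_cases hk2 : 2 ≤ k
      · exact hHCan hs ℓ k hlev hk2 hℓk ha ψ hψ
      · have hmin : min k ((padicValRat 2 q).toNat + 1) = 1 := by omega
        rw [hmin]
        exact h1
    · have hmin : min k ((padicValRat 2 q).toNat + 1) = 1 := by omega
      rw [hmin]
      exact h1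
  have hle : (padicValRat 2 q).toNat ≤ padicValNat 2 (Nat.card (AddCommGroup.primaryComponent W.sha 2)) := by
    refine shaAn_two_val_le_of_analyticClauseA_of_clauseB W f q ha ?_
    simp only [hs0, zero_add]
    exact hNV
  rw [hs0] at hle
  have hv0 : padicValRat 2 q = 0 := by
    have : (padicValRat 2 q).toNat = 0 := Nat.le_zero.mp hle
    omega
  refine ⟨by rw [hr, han], hfin, q, hq, ?_⟩
  rw [hv0, hs0]
  simp

/-- **Half-slice `{Ш_an(E) odd}`, per curve.**  A curve in the K2-F setting (as above, `Ш[2^∞]` finite of any order) whose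
`Ш_an = q` is a `2`-adic UNIT satisfies `BSDp W 2` as soon as: (HC at `W`): if `s ≥ 1` every first-layer row of level `k ≥ 2`
has `δ' ∈ 2^{min(k, s+1)}ℤ_{(2)}`; (NV_an at `W`, `s_an = 0`): some row of level `k ≥ 2` has `δ' ∉ 4ℤ_{(2)}`.  Proof: the rows
with `min = 1` of the algebraic clause (a) are `firstLayerLawAtTwo_clauseA_mod_two`; crosswise
(`sha_two_val_le_of_clauseA_of_analyticClauseB`) `s ≤ s_an = 0`.  (NV), (HC_an) and the `2`-integrality of `Ш_an` are NOT
used on this half. [folklore] kernel glue. -/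
theorem bsdp_two_of_shaAn_two_unit_of_higherCongruence_of_analyticNonVanishing
    (W : WeierstrassCurve ℚ) [W.IsElliptic] [W.IsGloballyMinimal] {M : ℕ} [NeZero M]
    (f : CuspForm (Gamma0 M) 2) (hf : IsNewformOf W f) (hper : PeriodTransferAtTwo W f)
    (hsurj : ∀ n : ℕ, W.HasSurjectiveModNGaloisRep ((2 ^ n : ℕ) : ℤ)) (hT : Odd W.torsionOrder)
    (hc : Odd W.tamagawaProduct) (hw : W.rootNumber = -1) (hr : W.mordellWeilRank = 1) (han : W.analyticRank = 1)
    (hfin : Finite (AddCommGroup.primaryComponent W.sha 2))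
    (q : ℚ) (hq : shaAn W = (q : ℂ)) (hunit : padicValRat 2 q = 0)
    (hHC : 1 ≤ padicValNat 2 (Nat.card (AddCommGroup.primaryComponent W.sha 2)) →
      ∀ (ℓ k : ℕ) [Fact ℓ.Prime], IsLevelAtTwo W ℓ → 2 ≤ k →
      (2 ^ k : ℤ) ∣ (ℓ : ℤ) - 1 → (2 ^ k : ℤ) ∣ W.frobeniusTrace ℓ - 2 →
      ∀ ψ : (ZMod ℓ)ˣ →* Multiplicative (ZMod (2 ^ k)), Function.Surjective ψ →
        InTwoPowZLoc (min k (padicValNat 2 (Nat.card (AddCommGroup.primaryComponent W.sha 2)) + 1))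
          (levelSumTwo f ℓ k ψ))
    (hNVan : ∃ (ℓ k : ℕ) (_ : Fact ℓ.Prime) (ψ : (ZMod ℓ)ˣ →* Multiplicative (ZMod (2 ^ k))),
      IsLevelAtTwo W ℓ ∧ 2 ≤ k ∧ (2 ^ k : ℤ) ∣ (ℓ : ℤ) - 1 ∧ (2 ^ k : ℤ) ∣ W.frobeniusTrace ℓ - 2 ∧
      Function.Surjective ψ ∧ ¬ InTwoPowZLoc 2 (levelSumTwo f ℓ k ψ)) :
    BSDp W 2 := by
  have hsan0 : (padicValRat 2 q).toNat = 0 := by rw [hunit]; rfl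
  -- full algebraic clause (a) at `W`
  have ha : ∀ (ℓ k : ℕ) [Fact ℓ.Prime], IsLevelAtTwo W ℓ → 1 ≤ k → (2 ^ k : ℤ) ∣ (ℓ : ℤ) - 1 →
      (2 ^ k : ℤ) ∣ W.frobeniusTrace ℓ - 2 →
      ∀ ψ : (ZMod ℓ)ˣ →* Multiplicative (ZMod (2 ^ k)), Function.Surjective ψ →
        InTwoPowZLoc (min k (padicValNat 2 (Nat.card (AddCommGroup.primaryComponent W.sha 2)) + 1))
          (levelSumTwo f ℓ k ψ) := by
    intro ℓ k _ hlev hk hℓk ha ψ hψ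
    have h1 : InTwoPowZLoc 1 (levelSumTwo f ℓ k ψ) :=
      firstLayerLawAtTwo_clauseA_mod_two W f hf hper hsurj hT hc hw hr hfin ℓ k hlev hk hℓk ha ψ hψ
    by_cases hs : 1 ≤ padicValNat 2 (Nat.card (AddCommGroup.primaryComponent W.sha 2))
    · by_cases hk2 : 2 ≤ k
      · exact hHC hs ℓ k hlev hk2 hℓk ha ψ hψ
      · have hmin : min k (padicValNat 2 (Nat.card (AddCommGroup.primaryComponent W.sha 2)) + 1) = 1 := by omega
        rw [hmin]
        exact h1
    · have hmin : min k (padicValNat 2 (Nat.card (AddCommGroup.primaryComponent W.sha 2)) + 1) = 1 := by omega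
      rw [hmin]
      exact h1
  have hle : padicValNat 2 (Nat.card (AddCommGroup.primaryComponent W.sha 2)) ≤ (padicValRat 2 q).toNat := by
    refine sha_two_val_le_of_clauseA_of_analyticClauseB W f q ha ?_
    simp only [hsan0, zero_add]
    exact hNVan
  rw [hsan0] at hle
  have hs0 : padicValNat 2 (Nat.card (AddCommGroup.primaryComponent W.sha 2)) = 0 := Nat.le_zero.mp hle
  refine ⟨by rw [hr, han], hfin, q, hq, ?_⟩
  rw [hunit, hs0]
  simp

/-! ## The two half-slices, by name -/

/-- **On `{Ш(E)[2] = 0}` the crux needs only (NV) and (HC_an)** (with the printed facts, the Manin residue and the integrality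
residue): for every slice curve with `#Ш[2^∞] = 1`, `BSDp W 2`.  The complement `{Ш(E)[2] ≠ 0}` is the residual stub of the
line `egg_kolyvagin_two` v6. [conjecture] inputs displayed; kernel glue. -/
theorem bsdp_two_on_shaTwoTrivial_of_residues
    (hGZK : rank_eq_analyticRank_of_analyticRank_le_one) (hmod : exists_isNewformOf)
    (hAU : abbesUllmo_not_dvd_maninConstant_of_not_dvd_level) (hC : cesnavicius_not_two_dvd_maninConstant_of_two_dvd_level)
    (hGZ : GrossZagier1986_thm_I_7_3)
    (hNV : FirstLayerNonVanishingAtTwo) (hHCan : AnalyticFirstLayerHigherCongruenceAtTwo)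
    (hManin : ManinOddAdditiveAtTwo) (hInt : ShaAnTwoIntegralOnBigImageSlice) :
    ∀ (W : WeierstrassCurve ℚ) [W.IsElliptic] [W.IsGloballyMinimal], ¬ W.HasCM →
      (∀ n : ℕ, W.HasSurjectiveModNGaloisRep ((2 ^ n : ℕ) : ℤ)) → Odd W.torsionOrder → Odd W.tamagawaProduct →
      W.analyticRank = 1 → Nat.card (AddCommGroup.primaryComponent W.sha 2) = 1 → BSDp W 2 := by
  intro W _ _ hcm hsurj hT hc han hcard
  haveI : NeZero (W.conductorNorm ℤ) := ⟨(W.conductorNorm_pos_holds).ne'⟩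
  obtain ⟨f, hf⟩ := hmod W
  have hw : W.rootNumber = -1 := rootNumber_eq_neg_one_of_analyticRank_eq_one W f hf han
  have hper : PeriodTransferAtTwo W f := periodTransferAtTwo_of_maninFacts hAU hC hManin W f hf hsurj
  obtain ⟨q, hq, hq0⟩ := exists_rat_shaAn_eq_and_ne_zero_of_analyticRank_eq_one hGZ hGZK W han
  have hint : 0 ≤ padicValRat 2 q := hInt W hcm hsurj hT hc han q hq
  obtain ⟨hrk, hshafin⟩ := hGZK W (by omega)
  have hr : W.mordellWeilRank = 1 := by omega
  have hfin : Finite (AddCommGroup.primaryComponent W.sha 2) := inferInstance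
  have HNV := hNV W f hf hper hsurj hT hc hw hr hfin
  have HHC := hHCan W f hf hper hsurj hT hc hw han q hq hq0
  simp only [hcard, padicValNat_one_right, zero_add] at HNV
  simp only at HHC
  exact bsdp_two_of_sha_two_trivial_of_nonVanishing_of_analyticHigherCongruence W f hf hper hsurj hT hc hw hr han hfin
    hcard q hq hq0 hint HNV HHC

/-- **On `{Ш_an(E) odd}` the crux needs only (HC) and (NV_an)** (with the printed facts and the Manin residue): for every slice
curve whose `Ш_an` is a `2`-adic unit, `BSDp W 2`. [conjecture] inputs displayed; kernel glue. -/
theorem bsdp_two_on_shaAnUnit_of_residues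
    (hGZK : rank_eq_analyticRank_of_analyticRank_le_one) (hmod : exists_isNewformOf)
    (hAU : abbesUllmo_not_dvd_maninConstant_of_not_dvd_level) (hC : cesnavicius_not_two_dvd_maninConstant_of_two_dvd_level)
    (hGZ : GrossZagier1986_thm_I_7_3)
    (hHC : FirstLayerHigherCongruenceAtTwo) (hNVan : AnalyticFirstLayerNonVanishingAtTwo)
    (hManin : ManinOddAdditiveAtTwo) :
    ∀ (W : WeierstrassCurve ℚ) [W.IsElliptic] [W.IsGloballyMinimal], ¬ W.HasCM →
      (∀ n : ℕ, W.HasSurjectiveModNGaloisRep ((2 ^ n : ℕ) : ℤ)) → Odd W.torsionOrder → Odd W.tamagawaProduct →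
      W.analyticRank = 1 → (∀ q : ℚ, shaAn W = (q : ℂ) → padicValRat 2 q = 0) → BSDp W 2 := by
  intro W _ _ _hcm hsurj hT hc han hunit
  haveI : NeZero (W.conductorNorm ℤ) := ⟨(W.conductorNorm_pos_holds).ne'⟩
  obtain ⟨f, hf⟩ := hmod W
  have hw : W.rootNumber = -1 := rootNumber_eq_neg_one_of_analyticRank_eq_one W f hf han
  have hper : PeriodTransferAtTwo W f := periodTransferAtTwo_of_maninFacts hAU hC hManin W f hf hsurj
  obtain ⟨q, hq, hq0⟩ := exists_rat_shaAn_eq_and_ne_zero_of_analyticRank_eq_one hGZ hGZK W han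
  have hq1 : padicValRat 2 q = 0 := hunit q hq
  obtain ⟨hrk, hshafin⟩ := hGZK W (by omega)
  have hr : W.mordellWeilRank = 1 := by omega
  have hfin : Finite (AddCommGroup.primaryComponent W.sha 2) := inferInstance
  have HHC := hHC W f hf hper hsurj hT hc hw hr hfin
  have HNV := hNVan W f hf hper hsurj hT hc hw han q hq hq0
  have hsan0 : (padicValRat 2 q).toNat = 0 := by rw [hq1]; rfl
  simp only [hsan0, zero_add] at HNV
  simp only at HHC
  exact bsdp_two_of_shaAn_two_unit_of_higherCongruence_of_analyticNonVanishing W f hf hper hsurj hT hc hw hr han hfin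
    q hq hq1 HHC HNV

end Summit.BirchSwinnertonDyer.BirchSwinnertonDyer.Theorems.RankOneAtTwoFkl

end
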